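import Summits.BirchSwinnertonDyer.BirchSwinnertonDyer.Theorems.EisensteinPrimesGoodLatticeKatzFrameStructure
import Summits.BirchSwinnertonDyer.BirchSwinnertonDyer.Theorems.UniversalToricDescentBDPFrameCrossPeriodRigidity
import HarnessLib

/-!
# Cross-period rigidity of the CGLS Katz frame `IsKatzLFunction`, IDEAL HALF: two `R₀` Katz frames of one `θ_K` at
# ANY two period pairs are `L'' = c·(1+T)^b·L` (`c ∈ R₀ˣ`, `b ∈ ℤ_p`), generate the SAME ideal of `Λ^{ur} = R₀⟦T⟧`,
# coincide at fixed periods; `∃`-frame ⇒ `∀`-frame for associate-invariant properties; and the Eisenstein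
# congruence (CGLS Thm. 2.2.1, conclusion shape of `proofThm221_congruence_of_fullEisensteinDescent`) passes from ONE
# (BDP, Katz) frame pair to EVERY frame pair
# (helper file 2 of 2 for crux 2 `GoodLatticeBDPValue`, stmt-BirchSwinnertonDyer-19032, line `halves` v34N; closes no stub)

Cell `bsd-eis` (run/shared/lean/pub/bsd-eis/), width seat `bsd-line-x1-p1-w2` gen 31. THEOREMS ONLY (no definition,
no named fact, no `sorry`; imports no `Theses` module); `--supports stmt-BirchSwinnertonDyer-19032`. Sequel of
`EisensteinPrimesGoodLatticeKatzFrameStructure` (supply along all powers, value relation, structural lemma).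

WHAT (`K` imaginary quadratic, `p` odd, `κ` anticyclotomic with topological generator `γ`, `θ_K` of finite order, all
periods non-zero, otherwise ARBITRARY):
* §1 `exists_eq_C_mul_binomialSeries_mul_of_isKatzLFunction` — STRUCTURAL CROSS-PERIOD RIGIDITY: `L ≠ 0` and `L''`
  Katz frames of `θ_K` ⟹ `L'' = c·(1+T)^b·L`, `c ∈ R₀ˣ`, `b ∈ ℤ_p` (`p`-contents `L = p^t L₀`, `L'' = p^{t''} L₀''`; the
  structural lemma for the `μ = 0` parts; `t = t''` by the first unit coefficient; descent of `c` to `R₀` at the first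
  unit coefficient of `(1+T)^b·L₀`); frames vanish together.
* §2 `span_singleton_eq_of_isKatzLFunction` — the Katz twin of `UniversalToricDescentTwinSplit.span_singleton_eq_of_isBDPLFunction`:
  `(L'') = (L)` in `R₀⟦T⟧`; `associated_of_isKatzLFunction`; `isKatzLFunction_unique` — at FIXED periods two frames
  COINCIDE («characterized by the following interpolation property», CGLS Thm. 2.1.2); `isKatzLFunction_forall_of_exists`;
  `forall_isKatzLFunction_of_exists_of_associated` — for every property `P` invariant under associates (membership in /
  equality with an ideal, divisibility, `μ`, `λ`), `P` at ONE frame gives `P` at EVERY frame;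
  `exists_firstUnitCoeffAt_of_associated` (`μ = 0` is such a property — the conclusion of
  `Hida2010MuInvariant.thmI_mu_katzLFunction_eq_zero`).
* §3 `exists_isUnit_congr_of_associated` — a congruence `L ≡ U·E·M² (mod 𝔪_{R₀}⟦T⟧)` up to a unit `U` passes to
  associates `L' ~ L`, `M' ~ M`; `eisensteinCongruence_of_framePair_of_framePair` — hence the conclusion shape of
  `CastellaGrossiLeeSkinner2022.proofThm221_congruence_of_fullEisensteinDescent` holds at EVERY (BDP frame, Katz frame)
  pair as soon as it holds at ONE (BDP span rigidity + Katz span rigidity).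

UPSHOT FOR THE BY-NAME SURFACE OF CRUX 2 (p763736, seven published names): the `∀ (Ω_K, Ω_p, L)`-frame phrasing of
`thmI_mu_katzLFunction_eq_zero` (Hida's `μ = 0` for THE measure) and of `proofThm221_…` (CGLS's congruence for THEIR
frames, unit `U` free) says no more than print PLUS these kernel theorems and the existence of one frame
(`thm212_exists_isKatzLFunction`, CGLS Thm. 2.1.2 / `castella2018_exists_isBDPLFunction`-type inputs) — the «frame
rigidity … not asserted separately» of their docstrings is now a theorem at the ideal level, for Katz frames as it
already was for BDP frames.

HONEST FRAMING: elementary `p`-adic analysis and bookkeeping over tree theorems; closes no stub; the registry (halves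
v34N, 2 cite-only stubs) is untouched; no summit statement, no case of BSD, no theorem of CGLS / Hida / Katz / Kriz is
proved here; 0 cells / labels / tiers move.

References: [CastellaGrossiLeeSkinner2022] Thm. 2.1.2 (arXiv:2008.02571v2 TeX L1015–1041), Thm. 2.2.1 and its proof
(L1051–L1116); [Castella2018] Thm. 3.1; [Washington1997] §7.1 Prop. 7.2, §7.2 Thm. 7.3; [Cassels1986] Ch. 4 Thm. 4.1;
[deShalit1987] II.4.12 Remark (iv); [Hida2010MuInvariant] Thm. I (statement shape only).
-/

set_option linter.dupNamespace false
set_option autoImplicit false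

noncomputable section

open scoped Classical Topology

open Filter PowerSeries NumberField IsDedekindDomain Field Literature.NumberTheory.EllipticCurves
  Literature.NumberTheory.EllipticCurves.CastellaGrossiLeeSkinner2022
  Literature.NumberTheory.EllipticCurves.KellerYin2024
  Literature.NumberTheory.GaloisRepresentations Literature.NumberTheory.GaloisRepresentations.HeckeCharacter
  Summit.BirchSwinnertonDyer.Rank1Residual Summit.BirchSwinnertonDyer.Rank1Residual.X11b
  Summit.BirchSwinnertonDyer.Rank1Residual.X11b.Halves
  Summit.BirchSwinnertonDyer.Rank1Residual.X11b.LambdaSupply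
  Summit.BirchSwinnertonDyer.Rank1Residual.X11b.Three.LambdaSupply
  Summit.BirchSwinnertonDyer.BirchSwinnertonDyer.Theorems.IwasawaTwoVariable
  Summit.BirchSwinnertonDyer.BirchSwinnertonDyer.Theorems.KatzLineRigidity

namespace Summit.BirchSwinnertonDyer.BirchSwinnertonDyer.Theorems.GoodLatticeKatzFrameRigidity

variable {p : ℕ} [hp : Fact p.Prime] {K : Type} [Field K] [NumberField K]

/-! ### §1 The structural form of two frames: `L'' = c·(1+T)^b·L`, `c ∈ R₀ˣ`, `b ∈ ℤ_p` -/

section Structure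

variable {ι : PadicAlgCl p ≃+* ℂ} {v vbar : HeightOneSpectrum (𝓞 K)} {Cbar : Finset (HeightOneSpectrum (𝓞 K))}
  {κ : ZpExtension K p} {γ : absoluteGaloisGroup K} {θK : HeckeCharacter K}
  {ΩK ΩK'' : ℂ} {Ωp Ωp'' : ℂ_[p]} {L L'' : UnrSeries p}

/-- **Two `R₀` Katz frames vanish together.** [cite: CastellaGrossiLeeSkinner2022, Thm. 2.1.2] [cite: Cassels1986, Ch. 4 Thm. 4.1] -/
theorem eq_zero_of_isKatzLFunction_of_eq_zero (hp2 : p ≠ 2) (hK : IsImaginaryQuadratic K)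
    (hκ : κ.IsAnticyclotomic) (hγ : κ.IsTopGenerator γ) (hfin : θK.IsFiniteOrder)
    (hΩK : ΩK ≠ 0) (hΩp : Ωp ≠ 0) (hΩK'' : ΩK'' ≠ 0) (hΩp'' : Ωp'' ≠ 0)
    (hL : IsKatzLFunction ι v vbar Cbar κ γ θK ΩK Ωp L)
    (hL'' : IsKatzLFunction ι v vbar Cbar κ γ θK ΩK'' Ωp'' L'') (h0 : L = 0) : L'' = 0 := by
  obtain ⟨u, d, hu, hu', hd, hrel⟩ :=
    exists_value_relation_of_isKatzLFunction hp2 hK hκ hγ hfin hΩK hΩp hΩK'' hΩp'' hL hL''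
  refine eq_zero_of_tsum_eq_zero hu hu' fun k hk ↦ ?_
  have h := hrel k hk
  rw [h0] at h
  simpa using h

/-- **STRUCTURAL CROSS-PERIOD RIGIDITY of the CGLS Katz frame.** `K` imaginary quadratic, `p` odd, `κ`
anticyclotomic with topological generator `γ`, `θ_K` of finite order, periods `Ω_K, Ω_K'' ∈ ℂˣ`,
`Ω_p, Ω_p'' ∈ ℂ_pˣ` otherwise ARBITRARY: if `L ≠ 0` and `L''` carry the CGLS interpolation property
`IsKatzLFunction ι v v̄ Cbar κ γ θ_K · · ·` at the two period pairs, then `L'' = c · (1+T)^b · L` with `c ∈ R₀ˣ`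
and `b ∈ ℤ_p` (`(1+T)^b ∈ ℤ_p⟦T⟧` read in `R₀⟦T⟧` through `toUnr`). Proof: value relation (file 1 §2), `p`-contents
`L = p^t L₀`, `L'' = p^{t''} L₀''`, the structural lemma for the `μ = 0` series, `t = t''` by the first unit
coefficient, and descent of the constant `c` to `R₀` at the first unit coefficient of `(1+T)^b·L₀`.
[cite: CastellaGrossiLeeSkinner2022, Thm. 2.1.2 (arXiv:2008.02571v2 TeX L1015–1041)] [cite: Washington1997, §7.1 Prop. 7.2, §7.2 Thm. 7.3]
[cite: deShalit1987, II.4.12 Remark (iv)] -/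
theorem exists_eq_C_mul_binomialSeries_mul_of_isKatzLFunction (hp2 : p ≠ 2) (hK : IsImaginaryQuadratic K)
    (hκ : κ.IsAnticyclotomic) (hγ : κ.IsTopGenerator γ) (hfin : θK.IsFiniteOrder)
    (hΩK : ΩK ≠ 0) (hΩp : Ωp ≠ 0) (hΩK'' : ΩK'' ≠ 0) (hΩp'' : Ωp'' ≠ 0)
    (hL : IsKatzLFunction ι v vbar Cbar κ γ θK ΩK Ωp L)
    (hL'' : IsKatzLFunction ι v vbar Cbar κ γ θK ΩK'' Ωp'' L'') (hL0 : L ≠ 0) :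
    ∃ (c : unrIntegers p) (b : ℤ_[p]), IsUnit c ∧
      L'' = C c * (PowerSeries.binomialSeries ℤ_[p] b).map (toUnr p) * L := by
  obtain ⟨u, d, hu, hu', hd, hrel⟩ :=
    exists_value_relation_of_isKatzLFunction hp2 hK hκ hγ hfin hΩK hΩp hΩK'' hΩp'' hL hL''
  have hL''0 : L'' ≠ 0 := by
    intro h0
    apply hL0
    refine eq_zero_of_tsum_eq_zero hu hu' fun k hk ↦ ?_
    have h := hrel k hk
    rw [h0] at h
    simp only [map_zero, ZeroMemClass.coe_zero, zero_mul, tsum_zero] at h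
    exact (mul_eq_zero.mp h.symm).resolve_left (pow_ne_zero _ hd)
  -- the `p`-contents
  obtain ⟨t, L₀, ⟨i, hi⟩, hLfac⟩ := RoadFFSaturation.exists_eq_C_pow_mul_of_ne_zero hL0
  obtain ⟨m, hm⟩ := exists_firstUnitCoeffAt_of_isUnit_coeff hi
  obtain ⟨t'', L₀'', ⟨i'', hi''⟩, hL''fac⟩ := RoadFFSaturation.exists_eq_C_pow_mul_of_ne_zero hL''0
  obtain ⟨m'', hm''⟩ := exists_firstUnitCoeffAt_of_isUnit_coeff hi''
  have hp0 : ((p : ℕ) : ℂ_[p]) ≠ 0 := by exact_mod_cast hp.out.ne_zero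
  -- the relation between the contents
  have hrel₀ : ∀ k : ℕ, 1 ≤ k →
      ((p : ℕ) : ℂ_[p]) ^ t'' * ∑' n, ((coeff n L₀'' : unrIntegers p) : ℂ_[p]) * (u ^ k - 1) ^ n =
        d ^ k * (((p : ℕ) : ℂ_[p]) ^ t * ∑' n, ((coeff n L₀ : unrIntegers p) : ℂ_[p]) * (u ^ k - 1) ^ n) := by
    intro k hk
    have h := hrel k hk
    rw [hLfac, hL''fac, tsum_coeff_C_pow_mul, tsum_coeff_C_pow_mul] at h
    exact h
  rcases Nat.lt_or_ge t'' t with hlt | hle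
  · -- `t'' < t` is impossible: `M' = p^{t−t''} L₀` would have a unit coefficient
    exfalso
    have hrel' : ∀ k : ℕ, 1 ≤ k →
        ∑' n, ((coeff n L₀'' : unrIntegers p) : ℂ_[p]) * (u ^ k - 1) ^ n =
          d ^ k * ∑' n, ((coeff n ((C ((p : ℕ) : unrIntegers p)) ^ (t - t'') * L₀) : unrIntegers p) :
            ℂ_[p]) * (u ^ k - 1) ^ n := by
      intro k hk
      rw [tsum_coeff_C_pow_mul]
      have h := hrel₀ k hk
      have e : ((p : ℕ) : ℂ_[p]) ^ t = ((p : ℕ) : ℂ_[p]) ^ t'' * ((p : ℕ) : ℂ_[p]) ^ (t - t'') := by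
        rw [← pow_add, Nat.add_sub_cancel' hlt.le]
      rw [e] at h
      apply mul_left_cancel₀ (pow_ne_zero t'' hp0)
      rw [h]
      ring
    obtain ⟨-, hfu⟩ := exists_eq_of_relation_of_firstUnitCoeffAt hm'' hu hu' hrel'
    exact absurd hfu.1 (norm_coe_coeff_C_pow_mul_lt_one (by omega) L₀ m'').ne
  · -- `t ≤ t''`: `M = p^{t''−t} L₀''` is `c (1+T)^b L₀`, so `t'' = t`
    have hrel' : ∀ k : ℕ, 1 ≤ k →
        ∑' n, ((coeff n L₀ : unrIntegers p) : ℂ_[p]) * (u ^ k - 1) ^ n =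
          d⁻¹ ^ k * ∑' n, ((coeff n ((C ((p : ℕ) : unrIntegers p)) ^ (t'' - t) * L₀'') : unrIntegers p) :
            ℂ_[p]) * (u ^ k - 1) ^ n := by
      intro k hk
      rw [tsum_coeff_C_pow_mul]
      have h := hrel₀ k hk
      have e : ((p : ℕ) : ℂ_[p]) ^ t'' = ((p : ℕ) : ℂ_[p]) ^ t * ((p : ℕ) : ℂ_[p]) ^ (t'' - t) := by
        rw [← pow_add, Nat.add_sub_cancel' hle]
      rw [e] at h
      have hdk : d ^ k ≠ 0 := pow_ne_zero _ hd
      apply mul_left_cancel₀ hdk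
      apply mul_left_cancel₀ (pow_ne_zero t hp0)
      rw [inv_pow, mul_inv_cancel_left₀ hdk]
      calc ((p : ℕ) : ℂ_[p]) ^ t * (d ^ k *
            ∑' n, ((coeff n L₀ : unrIntegers p) : ℂ_[p]) * (u ^ k - 1) ^ n)
          = d ^ k * (((p : ℕ) : ℂ_[p]) ^ t *
            ∑' n, ((coeff n L₀ : unrIntegers p) : ℂ_[p]) * (u ^ k - 1) ^ n) := by ring
        _ = ((p : ℕ) : ℂ_[p]) ^ t * ((p : ℕ) : ℂ_[p]) ^ (t'' - t) *
            ∑' n, ((coeff n L₀'' : unrIntegers p) : ℂ_[p]) * (u ^ k - 1) ^ n := h.symm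
        _ = ((p : ℕ) : ℂ_[p]) ^ t * (((p : ℕ) : ℂ_[p]) ^ (t'' - t) *
            ∑' n, ((coeff n L₀'' : unrIntegers p) : ℂ_[p]) * (u ^ k - 1) ^ n) := by ring
    obtain ⟨⟨c, b, hc, hMeq⟩, hfu⟩ := exists_eq_of_relation_of_firstUnitCoeffAt hm hu hu' hrel'
    have htt : t'' = t := by
      by_contra hne
      exact absurd hfu.1 (norm_coe_coeff_C_pow_mul_lt_one (by omega) L₀'' m).ne
    subst htt
    rw [Nat.sub_self, pow_zero, one_mul] at hMeq hfu
    -- descent of `c` to `R₀`: compare the coefficients at `m`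
    have hN := X1.KellerYinHalves.firstUnitCoeffAt_mul (firstUnitCoeffAt_binomialSeries_zero (p := p) b) hm
    rw [zero_add] at hN
    have hcoef : ((coeff m L₀'' : unrIntegers p) : ℂ_[p]) =
        c * ((coeff m ((PowerSeries.binomialSeries ℤ_[p] b).map (toUnr p) * L₀) : unrIntegers p) : ℂ_[p]) := by
      have h := congrArg (coeff m) hMeq
      rw [coeff_map_subtype, mul_assoc, coeff_C_mul, ← map_mul, coeff_map_subtype] at h
      exact h
    have hy1 := hN.1
    have hy0 : ((coeff m ((PowerSeries.binomialSeries ℤ_[p] b).map (toUnr p) * L₀) : unrIntegers p) : ℂ_[p]) ≠ 0 :=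
      norm_pos_iff.mp (by rw [hy1]; exact one_pos)
    have hc_eq : c = ((coeff m L₀'' : unrIntegers p) : ℂ_[p]) *
        (((coeff m ((PowerSeries.binomialSeries ℤ_[p] b).map (toUnr p) * L₀) : unrIntegers p) : ℂ_[p]))⁻¹ := by
      rw [hcoef, mul_inv_cancel_right₀ hy0]
    have hc_mem : c ∈ unrIntegers p := by
      rw [hc_eq]
      exact mul_mem (SetLike.coe_mem _) (unrIntegers.inv_mem_of_norm_eq_one (SetLike.coe_mem _) hy1)
    refine ⟨⟨c, hc_mem⟩, b, (unrIntegers.isUnit_iff_norm_eq_one _).mpr hc, ?_⟩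
    apply PowerSeries.map_injective (unrIntegers p).subtype Subtype.coe_injective
    rw [hL''fac, hLfac]
    simp only [map_mul, map_pow, PowerSeries.map_C]
    rw [hMeq]
    have e : (unrIntegers p).subtype ⟨c, hc_mem⟩ = c := rfl
    rw [e]
    ring

end Structure

/-! ### §2 Span rigidity, uniqueness at fixed periods, and the `∃`-frame ⇒ `∀`-frame transfers -/

section Span

variable {ι : PadicAlgCl p ≃+* ℂ} {v vbar : HeightOneSpectrum (𝓞 K)} {Cbar : Finset (HeightOneSpectrum (𝓞 K))}
  {κ : ZpExtension K p} {γ : absoluteGaloisGroup K} {θK : HeckeCharacter K}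
  {ΩK ΩK'' : ℂ} {Ωp Ωp'' : ℂ_[p]} {L L'' : UnrSeries p}

/-- **INTEGRAL CROSS-PERIOD RIGIDITY OF THE CGLS KATZ FRAME (span form).** `K` imaginary quadratic, `p` odd,
`κ` anticyclotomic with topological generator `γ`, `θ_K` of finite order, and ANY non-zero periods
`Ω_K, Ω_K'' ∈ ℂ`, `Ω_p, Ω_p'' ∈ ℂ_p`: two series `L, L'' ∈ R₀⟦T⟧` carrying the CGLS interpolation property
`IsKatzLFunction ι v v̄ Cbar κ γ θ_K · · ·` generate the SAME ideal of `Λ^{ur} = R₀⟦T⟧`. The Katz-frame twin of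
`UniversalToricDescentTwinSplit.span_singleton_eq_of_isBDPLFunction` (BDP frames).
[cite: CastellaGrossiLeeSkinner2022, Thm. 2.1.2 (arXiv:2008.02571v2 TeX L1015–1041)] [cite: Washington1997, §7.1 Prop. 7.2, §7.2 Thm. 7.3]
[cite: deShalit1987, II.4.12 Remark (iv)] -/
theorem span_singleton_eq_of_isKatzLFunction (hp2 : p ≠ 2) (hK : IsImaginaryQuadratic K)
    (hκ : κ.IsAnticyclotomic) (hγ : κ.IsTopGenerator γ) (hfin : θK.IsFiniteOrder)
    (hΩK : ΩK ≠ 0) (hΩp : Ωp ≠ 0) (hΩK'' : ΩK'' ≠ 0) (hΩp'' : Ωp'' ≠ 0)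
    (hL : IsKatzLFunction ι v vbar Cbar κ γ θK ΩK Ωp L)
    (hL'' : IsKatzLFunction ι v vbar Cbar κ γ θK ΩK'' Ωp'' L'') :
    Ideal.span ({L''} : Set (UnrSeries p)) = Ideal.span {L} := by
  by_cases h0 : L = 0
  · rw [h0, eq_zero_of_isKatzLFunction_of_eq_zero hp2 hK hκ hγ hfin hΩK hΩp hΩK'' hΩp'' hL hL'' h0]
  obtain ⟨c, b, hc, hEq⟩ :=
    exists_eq_C_mul_binomialSeries_mul_of_isKatzLFunction hp2 hK hκ hγ hfin hΩK hΩp hΩK'' hΩp'' hL hL'' h0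
  rw [hEq]
  exact Ideal.span_singleton_mul_left_unit
    (((hc.map (C (R := unrIntegers p))).mul (isUnit_binomialSeries_map_toUnr b))) L

/-- The two frames are ASSOCIATED in `R₀⟦T⟧` (`L'' = w · L`, `w` a unit).
[cite: CastellaGrossiLeeSkinner2022, Thm. 2.1.2] [cite: Washington1997, §7.1 Prop. 7.2] -/
theorem associated_of_isKatzLFunction (hp2 : p ≠ 2) (hK : IsImaginaryQuadratic K)
    (hκ : κ.IsAnticyclotomic) (hγ : κ.IsTopGenerator γ) (hfin : θK.IsFiniteOrder)
    (hΩK : ΩK ≠ 0) (hΩp : Ωp ≠ 0) (hΩK'' : ΩK'' ≠ 0) (hΩp'' : Ωp'' ≠ 0)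
    (hL : IsKatzLFunction ι v vbar Cbar κ γ θK ΩK Ωp L)
    (hL'' : IsKatzLFunction ι v vbar Cbar κ γ θK ΩK'' Ωp'' L'') : Associated L L'' :=
  Ideal.span_singleton_eq_span_singleton.mp
    (span_singleton_eq_of_isKatzLFunction hp2 hK hκ hγ hfin hΩK hΩp hΩK'' hΩp'' hL hL'').symm

/-- **UNIQUENESS AT FIXED PERIODS** («characterized by the following interpolation property», CGLS Thm. 2.1.2):
two `R₀` Katz frames of the same `θ_K` at the SAME period pair coincide. (`K` imaginary quadratic, `p` odd,
`κ` anticyclotomic with topological generator `γ`, `θ_K` of finite order; the frames take the same values at the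
points `u^{p^j} − 1 → 0` of the supply.) [cite: CastellaGrossiLeeSkinner2022, Thm. 2.1.2 (arXiv:2008.02571v2 TeX L1015–1041)]
[cite: Washington1997, §7.1 Thm. 7.3] -/
theorem isKatzLFunction_unique (hp2 : p ≠ 2) (hK : IsImaginaryQuadratic K)
    (hκ : κ.IsAnticyclotomic) (hγ : κ.IsTopGenerator γ) (hfin : θK.IsFiniteOrder)
    (hL : IsKatzLFunction ι v vbar Cbar κ γ θK ΩK Ωp L)
    (hL'' : IsKatzLFunction ι v vbar Cbar κ γ θK ΩK Ωp L'') : L = L'' := by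
  obtain ⟨n₁, u, φ, r, hn₁, hdvd, hu1, hune, hunr, hinf, hav, hfac, hval, hLc⟩ :=
    exists_katzSupply_pow hp2 ι hK hκ hγ hfin
  have hT : Tendsto (fun j : ℕ ↦ u ^ p ^ j - 1) atTop (𝓝 0) := by
    have := (tendsto_pow_prime_pow_padicComplex hu1).sub_const 1
    simpa using this
  have hk : ∀ j : ℕ, 1 ≤ p ^ j := fun j ↦ Nat.one_le_pow _ _ hp.out.pos
  refine unrSeries_eq_of_hasValueAt
    (v := fun j ↦ ((ι.symm (katzInterpolationValue p θK v vbar Cbar (φ (p ^ j)) (n₁ * p ^ j) ΩK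
      ((hLc (p ^ j) (hk j)).continuation 1)) : PadicAlgCl p) : ℂ_[p]) * Ωp ^ (2 * (n₁ * p ^ j)))
    hT (Frequently.of_forall fun j ↦ sub_ne_zero.mpr (hune j)) (fun j ↦ ?_) (fun j ↦ ?_)
  · have h := hL (φ (p ^ j)) (n₁ * p ^ j) (Nat.mul_pos hn₁ (hk j)) (Dvd.dvd.mul_right hdvd _)
      (hunr _) (hinf _) (hLc _ (hk j)) (r _) (hav _) (hfac _)
    rwa [hval] at h
  · have h := hL'' (φ (p ^ j)) (n₁ * p ^ j) (Nat.mul_pos hn₁ (hk j)) (Dvd.dvd.mul_right hdvd _)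
      (hunr _) (hinf _) (hLc _ (hk j)) (r _) (hav _) (hfac _)
    rwa [hval] at h

/-- **`∃`-frame ⇒ `∀`-frame at fixed periods**: a property of ONE frame is a property of EVERY frame with the
same periods. [cite: CastellaGrossiLeeSkinner2022, Thm. 2.1.2] -/
theorem isKatzLFunction_forall_of_exists (hp2 : p ≠ 2) (hK : IsImaginaryQuadratic K)
    (hκ : κ.IsAnticyclotomic) (hγ : κ.IsTopGenerator γ) (hfin : θK.IsFiniteOrder)
    {P : UnrSeries p → Prop} (hex : ∃ L, IsKatzLFunction ι v vbar Cbar κ γ θK ΩK Ωp L ∧ P L) :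
    ∀ L'', IsKatzLFunction ι v vbar Cbar κ γ θK ΩK Ωp L'' → P L'' := by
  intro L'' hL''
  obtain ⟨L, hL, hP⟩ := hex
  rwa [isKatzLFunction_unique hp2 hK hκ hγ hfin hL hL''] at hP

/-- **`∃`-frame ⇒ `∀`-frame ACROSS PERIODS for any property invariant under associates** (ideal-theoretic
statements: `μ`, `λ`, characteristic-ideal identities and inclusions, congruences up to units): if SOME Katz frame
`(Ω_K ≠ 0, Ω_p ≠ 0, L)` of `θ_K` has `P`, EVERY Katz frame of `θ_K` has `P`. So the universal quantification over
Katz frames in the tree's named facts `Hida2010MuInvariant.thmI_mu_katzLFunction_eq_zero` and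
`CastellaGrossiLeeSkinner2022.proofThm221_congruence_of_fullEisensteinDescent` costs exactly ONE frame.
[cite: CastellaGrossiLeeSkinner2022, Thm. 2.1.2] [cite: Washington1997, §7.1 Prop. 7.2] -/
theorem forall_isKatzLFunction_of_exists_of_associated (hp2 : p ≠ 2) (hK : IsImaginaryQuadratic K)
    (hκ : κ.IsAnticyclotomic) (hγ : κ.IsTopGenerator γ) (hfin : θK.IsFiniteOrder)
    {P : UnrSeries p → Prop} (hP : ∀ L L'' : UnrSeries p, Associated L L'' → P L → P L'')
    (hex : ∃ (ΩK : ℂ) (Ωp : ℂ_[p]) (L : UnrSeries p), ΩK ≠ 0 ∧ Ωp ≠ 0 ∧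
      IsKatzLFunction ι v vbar Cbar κ γ θK ΩK Ωp L ∧ P L) :
    ∀ (ΩK'' : ℂ) (Ωp'' : ℂ_[p]) (L'' : UnrSeries p), ΩK'' ≠ 0 → Ωp'' ≠ 0 →
      IsKatzLFunction ι v vbar Cbar κ γ θK ΩK'' Ωp'' L'' → P L'' := by
  intro ΩK'' Ωp'' L'' hΩK'' hΩp'' hL''
  obtain ⟨ΩK, Ωp, L, hΩK, hΩp, hL, hPL⟩ := hex
  exact hP L L'' (associated_of_isKatzLFunction hp2 hK hκ hγ hfin hΩK hΩp hΩK'' hΩp'' hL hL'') hPL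

/-- **`μ = 0` is invariant under associates** (a unit of `R₀⟦T⟧` has a unit constant term; Gauss's lemma for the
first unit coefficient), so by `forall_isKatzLFunction_of_exists_of_associated` the `∀`-frame conclusion
`∃ n, FirstUnitCoeffAt L n` of `Hida2010MuInvariant.thmI_mu_katzLFunction_eq_zero` follows from its instance at ONE
frame (re-deriving `GoodLatticeAnacongFrames.exists_coeff_norm_eq_one_of_isKatzLFunction_of_isKatzLFunction` from
span rigidity). [cite: Washington1997, §7.1 Prop. 7.2] -/
theorem exists_firstUnitCoeffAt_of_associated {L L'' : UnrSeries p} (h : Associated L L'')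
    (hμ : ∃ n, FirstUnitCoeffAt L n) : ∃ n, FirstUnitCoeffAt L'' n := by
  obtain ⟨w, rfl⟩ := h
  obtain ⟨n, hn⟩ := hμ
  have hw0 : FirstUnitCoeffAt (w : UnrSeries p) 0 := by
    refine ⟨?_, fun i hi ↦ (Nat.not_lt_zero i hi).elim⟩
    rw [coeff_zero_eq_constantCoeff]
    exact (unrIntegers.isUnit_iff_norm_eq_one _).mp (PowerSeries.isUnit_constantCoeff _ w.isUnit)
  have h := X1.KellerYinHalves.firstUnitCoeffAt_mul hn hw0
  rw [add_zero] at h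
  exact ⟨n, h⟩

end Span

/-! ### §3 Congruences modulo `𝔪_{R₀}` up to a unit pass between associates — the Eisenstein congruence
(CGLS Thm. 2.2.1, conclusion shape of `proofThm221_congruence_of_fullEisensteinDescent`) from ONE frame pair to
EVERY frame pair -/

section Congruence

/-- **A congruence `L ≡ U·E·M² (mod 𝔪_{R₀}⟦T⟧)` up to a unit `U` passes to associates**: if `L' ~ L` and
`M' ~ M` then `L' ≡ U'·E·M'² (mod 𝔪)` for another unit `U'` (`L' = w₁L`, `M' = w₂M`, `U' = U w₁ w₂⁻²`, and
`L' − U'EM'² = w₁(L − UEM²)`). The conclusion shape of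
`CastellaGrossiLeeSkinner2022.proofThm221_congruence_of_fullEisensteinDescent` (`E = (∏ 𝒫_w)`, squared there).
[cite: CastellaGrossiLeeSkinner2022, Thm. 2.2.1 (arXiv:2008.02571v2 TeX L1062–L1116)] [cite: Washington1997, §7.1] -/
theorem exists_isUnit_congr_of_associated {L L' M M' E U : UnrSeries p}
    (hL : Associated L L') (hM : Associated M M') (hU : IsUnit U)
    (h : ∀ i : ℕ, ‖((coeff i L : unrIntegers p) : ℂ_[p]) -
      ((coeff i (U * E * M ^ 2) : unrIntegers p) : ℂ_[p])‖ < 1) :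
    ∃ U' : UnrSeries p, IsUnit U' ∧
      ∀ i : ℕ, ‖((coeff i L' : unrIntegers p) : ℂ_[p]) -
        ((coeff i (U' * E * M' ^ 2) : unrIntegers p) : ℂ_[p])‖ < 1 := by
  obtain ⟨w₁, rfl⟩ := hL
  obtain ⟨w₂, rfl⟩ := hM
  refine ⟨U * (w₁ : UnrSeries p) * ((w₂⁻¹ : (UnrSeries p)ˣ) : UnrSeries p) ^ 2,
    (hU.mul w₁.isUnit).mul ((w₂⁻¹).isUnit.pow 2), fun i ↦ ?_⟩
  have key : L * (w₁ : UnrSeries p) -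
      U * (w₁ : UnrSeries p) * ((w₂⁻¹ : (UnrSeries p)ˣ) : UnrSeries p) ^ 2 * E * (M * (w₂ : UnrSeries p)) ^ 2 =
      (w₁ : UnrSeries p) * (L - U * E * M ^ 2) := by
    have hw : ((w₂⁻¹ : (UnrSeries p)ˣ) : UnrSeries p) * (w₂ : UnrSeries p) = 1 := by
      rw [← Units.val_mul, inv_mul_cancel, Units.val_one]
    calc L * (w₁ : UnrSeries p) -
          U * (w₁ : UnrSeries p) * ((w₂⁻¹ : (UnrSeries p)ˣ) : UnrSeries p) ^ 2 * E * (M * (w₂ : UnrSeries p)) ^ 2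
        = L * (w₁ : UnrSeries p) -
          U * (w₁ : UnrSeries p) * E * M ^ 2 * (((w₂⁻¹ : (UnrSeries p)ˣ) : UnrSeries p) * (w₂ : UnrSeries p)) ^ 2 := by
            ring
      _ = (w₁ : UnrSeries p) * (L - U * E * M ^ 2) := by rw [hw]; ring
  have hD : ∀ j : ℕ, ‖((coeff j (L - U * E * M ^ 2) : unrIntegers p) : ℂ_[p])‖ < 1 := by
    intro j; rw [map_sub, AddSubgroupClass.coe_sub]; exact h j
  have := norm_coe_coeff_mul_lt_one (w₁ : UnrSeries p) (L - U * E * M ^ 2) hD i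
  rwa [← key, map_sub, AddSubgroupClass.coe_sub] at this

variable {ι : PadicAlgCl p ≃+* ℂ} {v vbar : HeightOneSpectrum (𝓞 K)} {Cbar : Finset (HeightOneSpectrum (𝓞 K))}
  {κ : ZpExtension K p} {γ : absoluteGaloisGroup K} {θK : HeckeCharacter K} {N : ℕ}
  {f : CuspForm (CongruenceSubgroup.Gamma0 N) 2}
  {ΩK₁ ΩK₂ ΩK₃ ΩK₄ : ℂ} {Ωp₁ Ωp₂ Ωp₃ Ωp₄ : ℂ_[p]} {L₁ L₂ M₁ M₂ : UnrSeries p}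

/-- **THE EISENSTEIN CONGRUENCE PASSES FROM ONE FRAME PAIR TO EVERY FRAME PAIR** — the print-faithfulness
certificate for the `∀ (BDP frame) ∀ (Katz frame)` phrasing of the conclusion of
`CastellaGrossiLeeSkinner2022.proofThm221_congruence_of_fullEisensteinDescent` (CGLS prove
`𝓛_E ≡ (𝓔^ι)²·𝓛_φ² (mod pΛ^{ur})` for THEIR frames; the tree quantifies over all frames with a free unit `U`).
`K` imaginary quadratic, `p` odd, `κ` anticyclotomic with topological generator `γ`, `θ_K` of finite order, all periods
non-zero: if `L₁ ≡ U·E·M₁² (mod 𝔪)` for ONE BDP frame `L₁` of `f` and ONE Katz frame `M₁` of `θ_K`, then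
`L₂ ≡ U'·E·M₂² (mod 𝔪)` for EVERY BDP frame `L₂` of `f` and EVERY Katz frame `M₂` of `θ_K`, `U'` a unit
(BDP span rigidity `UniversalToricDescentTwinSplit.span_singleton_eq_of_isBDPLFunction` + Katz span rigidity §2).
[cite: CastellaGrossiLeeSkinner2022, Thm. 2.2.1 and its proof (arXiv:2008.02571v2 TeX L1062–L1116), Thm. 2.1.2] [cite: Castella2018, Thm. 3.1]
[cite: Washington1997, §7.1 Prop. 7.2] -/
theorem eisensteinCongruence_of_framePair_of_framePair (hp2 : p ≠ 2) (hK : IsImaginaryQuadratic K)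
    (hκ : κ.IsAnticyclotomic) (hγ : κ.IsTopGenerator γ) (hfin : θK.IsFiniteOrder)
    (hΩK₁ : ΩK₁ ≠ 0) (hΩp₁ : Ωp₁ ≠ 0) (hΩK₂ : ΩK₂ ≠ 0) (hΩp₂ : Ωp₂ ≠ 0)
    (hΩK₃ : ΩK₃ ≠ 0) (hΩp₃ : Ωp₃ ≠ 0) (hΩK₄ : ΩK₄ ≠ 0) (hΩp₄ : Ωp₄ ≠ 0)
    (hL₁ : IsBDPLFunction ι v κ γ f ΩK₁ Ωp₁ L₁) (hL₂ : IsBDPLFunction ι v κ γ f ΩK₂ Ωp₂ L₂)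
    (hM₁ : IsKatzLFunction ι v vbar Cbar κ γ θK ΩK₃ Ωp₃ M₁)
    (hM₂ : IsKatzLFunction ι v vbar Cbar κ γ θK ΩK₄ Ωp₄ M₂)
    {E U : UnrSeries p} (hU : IsUnit U)
    (h : ∀ i : ℕ, ‖((coeff i L₁ : unrIntegers p) : ℂ_[p]) -
      ((coeff i (U * E * M₁ ^ 2) : unrIntegers p) : ℂ_[p])‖ < 1) :
    ∃ U' : UnrSeries p, IsUnit U' ∧
      ∀ i : ℕ, ‖((coeff i L₂ : unrIntegers p) : ℂ_[p]) -
        ((coeff i (U' * E * M₂ ^ 2) : unrIntegers p) : ℂ_[p])‖ < 1 := by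
  have hL : Associated L₁ L₂ :=
    Ideal.span_singleton_eq_span_singleton.mp
      (UniversalToricDescentTwinSplit.span_singleton_eq_of_isBDPLFunction hK hκ hγ hΩK₁ hΩK₂ hΩp₁ hΩp₂
        hL₁ hL₂).symm
  have hM : Associated M₁ M₂ := associated_of_isKatzLFunction hp2 hK hκ hγ hfin hΩK₃ hΩp₃ hΩK₄ hΩp₄ hM₁ hM₂
  exact exists_isUnit_congr_of_associated hL hM hU h

end Congruence

end Summit.BirchSwinnertonDyer.BirchSwinnertonDyer.Theorems.GoodLatticeKatzFrameRigidity

end
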